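import Summits.CriticalPhenomena.PercolationContinuityZ3.Theorems.PercNearOneGluingNoHeavyLowerTailSahiLatinFiveSet

/-!
# `NoHeavyLowerTail` (crux stmt-CriticalPhenomena-4575), Sahi programme (prim-master-conj gen 49): THE ZERO-BOTTOM DEFECT FUNCTIONAL `Ψ`
# and its four grid parts — `2·κ_{n+1}(cylinder, lower step, lower step) − 3·κ_n(top sections) = 9·κ(F,P,Q) + Ψ`

Support file (`--supports stmt-CriticalPhenomena-4575`; toolkit: definitions + identities).  Memo
`run/shared/lean/prim/prim-l12/FROM-prim-master-conj-g49-PEELING-THEOREM.md` §§1–3.  Nothing here asserts the crux, Kahn's conjecture or (C¼).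

THE MATHEMATICS.  For finsets `F, P, b, Q, c` of `[3]^κ` (think: `P ⊥ Q` up-sets on disjoint blocks, `F ⊇ P ∪ Q`, `b = P' ∖ P`, `c = Q' ∖ Q` —
prim-ineq-gen-4's ZERO-BOTTOM FAMILY, on which `κ(F,P,Q) = 0`), with `S1`, `latinPairs` (`L`), `latinTriples` (`L₃`) of `…SahiLatinFunctionals`:
  `cSS = 2S1(F∩Q∩b) + 2S1(F∩P∩c) + 2S1(F∩b∩c)`,           `cSO = −L(F∩P, c) − L(F∩b, Q) + 3L(F∩b, c)`,
  `cOS = −L(F∩Q, b) − L(F∩c, P) + 3L(F∩c, b)`,              `cOO = L₃(F,P,c) + L₃(F,b,Q) − 3L₃(F,b,c) − L(F,Q∩b) − L(F,P∩c) − L(F,b∩c)`,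
  `Psi = cSS + cSO + cOS + cOO`  (= `s1 + s2 + h − 3D` of the memo: `s1 = κ(F,P,c)`, `s2 = κ(F,b,Q)`, `h = 2S1(F∩b∩c) − L(F,b∩c)`,
  `D = L₃(F,b,c) − L(F∩c,b) − L(F∩b,c)`).  The four parts are the classes of the 15 Latin monomials of `Ψ` under "does the point carrying
  `P`/`b` (resp. `Q`/`c`) coincide with the point carrying `F`" — the split that makes one-coordinate peeling diagonal (memo §2–3).
THEOREM (`two_kappa_lowerStep_sub_three_kappa_top`, every `κ`, `P ⊆ P'`, `Q ⊆ Q'`, `F` arbitrary):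
  `2·κ(ofSections F F F, ofSections P P P', ofSections Q Q Q') − 3·κ(F,P',Q') = 9·κ(F,P,Q) + Psi F P (P'∖P) Q (Q'∖Q)`.
Hence on the zero-bottom family (`κ(F,P,Q) = 0`, `…SahiGridPatternZeroLocus`/`MeetFace` for `P ⊥ Q`, `P∪Q ⊆ F`) top-slice dominance with the
constant `3/2` for the lower-step clothing — prim-ineq-gen-4's `4c₁ ≥ 3c₃`, the lower-step form of (C¼) `4c₂ ≥ 7c₃` — is EXACTLY `0 ≤ Psi`
(`three_kappa_top_le_iff_psi_nonneg`).  Everything here is an identity; axioms standard. [this work]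
-/

namespace Summit.CriticalPhenomena.PercolationContinuityZ3.Theorems.SahiLatin

open Finset

variable {κ : Type*} [Fintype κ] [DecidableEq κ]

/-! ## §1  The four grid parts and `Ψ` -/

/-- `cSS(F;P,b,Q,c) = 2S1(F∩Q∩b) + 2S1(F∩P∩c) + 2S1(F∩b∩c)` (monomials whose `P/b`- and `Q/c`-carriers are both the `F`-point). [this work] -/
def cSS (F P b Q c : Finset (Pt κ)) : ℤ := 2 * S1 (F ∩ Q ∩ b) + 2 * S1 (F ∩ P ∩ c) + 2 * S1 (F ∩ b ∩ c)

/-- `cSO(F;P,b,Q,c) = −L(F∩P,c) − L(F∩b,Q) + 3L(F∩b,c)` (`P/b` at the `F`-point, `Q/c` at the other point). [this work] -/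
def cSO (F P b Q c : Finset (Pt κ)) : ℤ := -latinPairs (F ∩ P) c - latinPairs (F ∩ b) Q + 3 * latinPairs (F ∩ b) c

/-- `cOS(F;P,b,Q,c) = −L(F∩Q,b) − L(F∩c,P) + 3L(F∩c,b)` (`Q/c` at the `F`-point, `P/b` at the other point). [this work] -/
def cOS (F P b Q c : Finset (Pt κ)) : ℤ := -latinPairs (F ∩ Q) b - latinPairs (F ∩ c) P + 3 * latinPairs (F ∩ c) b

/-- `cOO(F;P,b,Q,c) = L₃(F,P,c) + L₃(F,b,Q) − 3L₃(F,b,c) − L(F,Q∩b) − L(F,P∩c) − L(F,b∩c)` (both carriers away from the `F`-point). [this work] -/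
def cOO (F P b Q c : Finset (Pt κ)) : ℤ :=
  latinTriples F P c + latinTriples F b Q - 3 * latinTriples F b c - latinPairs F (Q ∩ b) - latinPairs F (P ∩ c) - latinPairs F (b ∩ c)

/-- **The zero-bottom defect functional** `Ψ = cSS + cSO + cOS + cOO` (`= s1 + s2 + h − 3D` of the memo). [this work] -/
def Psi (F P b Q c : Finset (Pt κ)) : ℤ := cSS F P b Q c + cSO F P b Q c + cOS F P b Q c + cOO F P b Q c

omit [DecidableEq κ] in
/-- The indicator of a difference `P' ∖ P` with `P ⊆ P'`. [this work] -/
theorem ind_sdiff_of_subset {P P' : Finset (Pt κ)} (h : P ⊆ P') (y : Pt κ) : ind (P' \ P) y = ind P' y - ind P y := by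
  simp only [ind_apply, mem_sdiff]
  by_cases h1 : y ∈ P <;> by_cases h2 : y ∈ P' <;> simp [h1, h2]
  exact absurd (h h1) h2

/-! ## §2  The clothing identity -/

/-- **`2·κ_{n+1}(lower-step clothing) − 3·κ_n(top sections) = 9·κ(F,P,Q) + Ψ`** (every `κ`; `P ⊆ P'`, `Q ⊆ Q'`, `F` arbitrary): for the triple
(cylinder over `F`, lower step `(P,P,P')`, lower step `(Q,Q,Q')`) of `[3]^{Option κ}`,
`2·kappa (ofSections F F F) (ofSections P P P') (ofSections Q Q Q') − 3·kappa F P' Q' = 9·kappa F P Q + Psi F P (P'∖P) Q (Q'∖Q)`. [this work] -/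
theorem two_kappa_lowerStep_sub_three_kappa_top {F P P' Q Q' : Finset (Pt κ)} (hP : P ⊆ P') (hQ : Q ⊆ Q') :
    2 * kappa (ofSections F F F) (ofSections P P P') (ofSections Q Q Q') - 3 * kappa F P' Q' =
      9 * kappa F P Q + Psi F P (P' \ P) Q (Q' \ Q) := by
  rw [kappa_cyl_lowerStep_lowerStep_of_subset hP hQ, kappa_eq_functionals F P Q, kappa_eq_functionals F P Q',
    kappa_eq_functionals F P' Q, kappa_eq_functionals F P' Q']
  rw [latinPairs_comm (P ∩ Q) F, latinPairs_comm (P ∩ Q') F, latinPairs_comm (P' ∩ Q) F, latinPairs_comm (P' ∩ Q') F]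
  unfold Psi cSS cSO cOS cOO S1 latinPairs latinTriples
  simp only [ind_inter, ind_sdiff_of_subset hP, ind_sdiff_of_subset hQ]
  simp only [mul_add, mul_sub, mul_sum]
  simp only [← sum_add_distrib, ← sum_sub_distrib, ← sum_neg_distrib]
  refine sum_congr rfl fun σ _ => ?_
  ring

/-- **Zero-bottom form of top-slice dominance with constant `3/2`.**  If `κ(F,P,Q) = 0` (e.g. `P ⊥ Q` on disjoint blocks and `P ∪ Q ⊆ F`) then
`3·κ(F,P',Q') ≤ 2·κ(lower-step clothing)` (cube: `4c₁ ≥ 3c₃`) holds iff `0 ≤ Psi F P (P'∖P) Q (Q'∖Q)`. [this work] -/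
theorem three_kappa_top_le_iff_psi_nonneg {F P P' Q Q' : Finset (Pt κ)} (hP : P ⊆ P') (hQ : Q ⊆ Q') (h0 : kappa F P Q = 0) :
    3 * kappa F P' Q' ≤ 2 * kappa (ofSections F F F) (ofSections P P P') (ofSections Q Q Q') ↔ 0 ≤ Psi F P (P' \ P) Q (Q' \ Q) := by
  have h := two_kappa_lowerStep_sub_three_kappa_top (F := F) hP hQ
  rw [h0, mul_zero, zero_add] at h
  constructor
  · intro hle; linarith
  · intro hge; linarith

end Summit.CriticalPhenomena.PercolationContinuityZ3.Theorems.SahiLatin
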